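import Summits.Parity.GeneralizedHardyLittlewood.Theorems.PrimeLevelFamEdgeIdeaDeltasPeterssonLayersSplit
import Literature.Algebra.Polynomial.ChebyshevQuadraticCommutant
import HarnessLib

/-!
# Route `PrimeLevelFamEdge`, crux K_A `MomentsBeyondDiagonal` (stmt-Parity-20007), line «petersson_layers» v4, stub `stub_diag`:
# **`secondMomentForm` ORDER BY ORDER: `secondMomentForm Δ P Q = Σ_{i,j ≤ deg Q} QᵢQⱼ·B_{ij}(Δ,P)` for EVERY `Q`, and the
# identification `τ_{ij} = B_{ij}/2` of the per-order targets (the lemma `secondMomentForm_eq_sum_orders` asked for in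
# `Cruxes/MomentsBeyondDiagonal/Lines/petersson_layers_stub_diag_g8_orders.md`)**

The general-`Q` assembly of `stub_diag` (`…DiagOrderAssembly.hasShape_diagPart_of_orderAsymptotics`,
`…DiagOrderSelberg.subDiag_of_selbergOrderAsymptotics`) produces `HasShape diagPart Δ t` with the level-free functional
`t(Δ',P,Q) = Σ_{i,j ≤ deg Q} QᵢQⱼ(1+(−1)^{i+j})·τ_{ij}(Δ',P)` from per-order targets `τ_{ij}`. This file supplies the pure
polynomial algebra that turns the expected targets `τ_{ij} = B_{ij}/2` into `t = secondMomentForm`: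

* `eval_one_eq_sum_coeff`, `derivative_eval_one_eq_sum_coeff`, `linForm_eq_sum_coeff`, `linForm_sq_eq_sum_sum` —
  `Q(1) = ΣQᵢ`, `Q′(1) = Σ iQᵢ`, `linForm Δ P Q = Σᵢ Qᵢ(P′(1) + iΔP(1))`, its square as a double sum;
* `unitIntegral_mul_eq_sum_sum` — **`∫₀¹ R·S = Σ_{a<m}Σ_{b<n} R_aS_b/(a+b+1)`** (`deg R < m`, `deg S < n`);
* `coeff_derivative_derivative`, `sum_range_shift_two` — `Q″_b = Q_{b+2}(b+2)(b+1)` and the re-indexing `j = b+2`;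
* `unitIntegral_sq_eq_sum_sum` (`I(Q²) = ΣΣ QᵢQⱼ/(i+j+1)`), `unitIntegral_mul_derivative_two_eq_sum_sum`
  (`I(QQ″) = ΣΣ QᵢQⱼ·j(j−1)/(i+j−1)`), `unitIntegral_derivative_two_sq_eq_sum_sum` (`I(Q″²) = ΣΣ QᵢQⱼ·i(i−1)j(j−1)/(i+j−3)`),
  all over `i, j ∈ range(deg Q + 1)` (terms with a vanishing numerator are `0` whatever the denominator);
* `secondMomentForm_eq_sum_orders` — **for `Δ ≠ 0` and EVERY `Q`:
  `secondMomentForm Δ P Q = Σ_{i,j ≤ deg Q} QᵢQⱼ B_{ij}(Δ,P)`,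
  `B_{ij} = (P′(1)+iΔP(1))(P′(1)+jΔP(1)) + I(P″²)/(Δ(i+j+1)) − Δ(i(i−1)+j(j−1))/(i+j−1)·I(P″P) + Δ³i(i−1)j(j−1)/(i+j−3)·I(P²)`**
  (from `KMV2000.offDiagForm_eq_expanded`, symmetrised in `(i,j)`);
* `coeff_mul_coeff_eq_zero_of_isEvenOrOdd`, `sum_sum_parity_factor` — for even-or-odd `Q`, `QᵢQⱼ = 0` unless `i+j` is even,
  hence `Σ QᵢQⱼ(1+(−1)^{i+j})τ_{ij} = 2Σ QᵢQⱼτ_{ij}`;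
* `secondMomentForm_eq_sum_orders_parity` — **for even-or-odd `Q`: `Σ_{i,j} QᵢQⱼ(1+(−1)^{i+j})·(B_{ij}/2) = secondMomentForm Δ P Q`**;
* `hasShape_congr`, `hasShape_secondMomentForm_of_orderForm` — **`HasShape F Δ (Σ QᵢQⱼ(1+(−1)^{i+j})B_{ij}/2) → HasShape F Δ secondMomentForm`**
  for any level family `F`: with `τ_{ij} := B_{ij}/2` the per-order assembly yields the printed shape `t_D = secondMomentForm`
  (consistent with the proved `τ₀₀ = secondMomentForm Δ P 1/2`, `…DiagOrderZero`, and the hand value `τ₁₁ = B₁₁/2` of the g10 census).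

Pure algebra; def-free; theorems only. Helper `--supports stmt-Parity-20007`; closes nothing; K_A, K_B and the Parity summit
are NOT proved; nothing about Landau–Siegel zeros.

## References
* E. Kowalski, P. Michel, J. VanderKam, J. reine angew. Math. 526 (2000), §6 (30)–(32), §7 (33).
  [cite: KowalskiMichelVanderKam2000, (30)–(33) — derivation (the main-term forms order by order in the coefficients of `Q`)]
-/

noncomputable section

open Finset Polynomial MeasureTheory intervalIntegral

namespace Summit.Parity.GeneralizedHardyLittlewood.Theorems.MomentsBeyondDiagonal.DiagLines

open Literature.NumberTheory.LFunctions Literature.NumberTheory.LFunctions.KMV2000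
open Summit.Parity.GeneralizedHardyLittlewood.Theorems.PrimeLevelFamEdgeIdeaDeltas.PeterssonLayers (LevelFamily HasShape)
open Literature.Algebra.Polynomial.ChebyshevQuadraticCommutant (coeff_eq_zero_of_comp_neg_X_eq_self)
open Literature.Algebra.Polynomial.ChebyshevChains (coeff_eq_zero_of_comp_neg_X_eq_neg)

/-! ### `Q(1)`, `Q′(1)` and the linear form by coefficients -/

/-- `Q(1) = Σ_{i ≤ deg Q} Qᵢ`. [folklore] -/
theorem eval_one_eq_sum_coeff (Q : ℝ[X]) : Q.eval 1 = ∑ i ∈ range (Q.natDegree + 1), Q.coeff i := by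
  rw [eval_eq_sum_range]
  simp

/-- `Q′(1) = Σ_{i ≤ deg Q} i·Qᵢ`. [folklore] -/
theorem derivative_eval_one_eq_sum_coeff (Q : ℝ[X]) :
    (derivative Q).eval 1 = ∑ i ∈ range (Q.natDegree + 1), (i : ℝ) * Q.coeff i := by
  have h := Polynomial.sum_over_range Q (f := fun n a ↦ a * (n : ℝ) * (1 : ℝ) ^ (n - 1)) (fun n ↦ by simp)
  rw [derivative_eval, h]
  exact Finset.sum_congr rfl fun i _ ↦ by simp [mul_comm]

/-- **`linForm Δ P Q = Σ_{i ≤ deg Q} Qᵢ·(P′(1) + iΔP(1))`.** [cite: KowalskiMichelVanderKam2000, §6 (30) — derivation] -/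
theorem linForm_eq_sum_coeff (Δ : ℝ) (P Q : ℝ[X]) :
    linForm Δ P Q = ∑ i ∈ range (Q.natDegree + 1),
      Q.coeff i * ((derivative P).eval 1 + (i : ℝ) * Δ * P.eval 1) := by
  unfold linForm
  rw [eval_one_eq_sum_coeff Q, derivative_eval_one_eq_sum_coeff Q]
  simp only [Finset.sum_mul, Finset.mul_sum, ← Finset.sum_add_distrib]
  exact Finset.sum_congr rfl fun i _ ↦ by ring

/-- `linForm² = Σᵢ Σⱼ QᵢQⱼ(P′(1)+iΔP(1))(P′(1)+jΔP(1))`. [cite: KowalskiMichelVanderKam2000, §6 (31) — derivation] -/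
theorem linForm_sq_eq_sum_sum (Δ : ℝ) (P Q : ℝ[X]) :
    linForm Δ P Q ^ 2 = ∑ i ∈ range (Q.natDegree + 1), ∑ j ∈ range (Q.natDegree + 1),
      Q.coeff i * Q.coeff j * (((derivative P).eval 1 + (i : ℝ) * Δ * P.eval 1) *
        ((derivative P).eval 1 + (j : ℝ) * Δ * P.eval 1)) := by
  rw [sq, linForm_eq_sum_coeff, Finset.sum_mul_sum]
  exact Finset.sum_congr rfl fun i _ ↦ Finset.sum_congr rfl fun j _ ↦ by ring

/-! ### `∫₀¹` of products of polynomials by coefficients -/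

/-- **`∫₀¹ R·S = Σ_{a<m}Σ_{b<n} R_a S_b/(a+b+1)`** whenever `deg R < m`, `deg S < n`. [folklore] -/
theorem unitIntegral_mul_eq_sum_sum (R S : ℝ[X]) {m n : ℕ} (hm : R.natDegree < m) (hn : S.natDegree < n) :
    unitIntegral (R * S) = ∑ a ∈ range m, ∑ b ∈ range n, R.coeff a * S.coeff b / ((a : ℝ) + b + 1) := by
  unfold unitIntegral
  have hpt : ∀ y : ℝ, (R * S).eval y = ∑ a ∈ range m, ∑ b ∈ range n, R.coeff a * S.coeff b * y ^ (a + b) := by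
    intro y
    rw [eval_mul, eval_eq_sum_range' hm, eval_eq_sum_range' hn, Finset.sum_mul_sum]
    refine Finset.sum_congr rfl fun a _ ↦ Finset.sum_congr rfl fun b _ ↦ ?_
    rw [pow_add]
    ring
  simp_rw [hpt]
  have hint : ∀ (a b : ℕ), IntervalIntegrable (fun y : ℝ ↦ R.coeff a * S.coeff b * y ^ (a + b)) volume 0 1 :=
    fun a b ↦ (continuous_const.mul (continuous_pow _)).intervalIntegrable _ _
  rw [intervalIntegral.integral_finsetSum (f := fun a y ↦ ∑ b ∈ range n, R.coeff a * S.coeff b * y ^ (a + b))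
    (fun a _ ↦ (continuous_finsetSum _ fun b _ ↦ (continuous_const.mul (continuous_pow (a + b)))).intervalIntegrable _ _)]
  refine Finset.sum_congr rfl fun a _ ↦ ?_
  rw [intervalIntegral.integral_finsetSum (f := fun b y ↦ R.coeff a * S.coeff b * y ^ (a + b)) (fun b _ ↦ hint a b)]
  refine Finset.sum_congr rfl fun b _ ↦ ?_
  rw [intervalIntegral.integral_const_mul, integral_pow, one_pow, zero_pow (Nat.succ_ne_zero _)]
  push_cast
  ring

/-- `I(Q²) = Σᵢ Σⱼ QᵢQⱼ/(i+j+1)` over `i, j ≤ deg Q`. [cite: KowalskiMichelVanderKam2000, §7 (33) — derivation] -/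
theorem unitIntegral_sq_eq_sum_sum (Q : ℝ[X]) :
    unitIntegral (Q ^ 2) = ∑ i ∈ range (Q.natDegree + 1), ∑ j ∈ range (Q.natDegree + 1),
      Q.coeff i * Q.coeff j / ((i : ℝ) + j + 1) := by
  rw [sq]
  exact unitIntegral_mul_eq_sum_sum Q Q (Nat.lt_succ_self _) (Nat.lt_succ_self _)

/-- `Q″_b = Q_{b+2}·(b+2)(b+1)`. [folklore] -/
theorem coeff_derivative_derivative (Q : ℝ[X]) (b : ℕ) :
    (derivative (derivative Q)).coeff b = Q.coeff (b + 2) * (((b : ℝ) + 2) * ((b : ℝ) + 1)) := by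
  rw [coeff_derivative, coeff_derivative]
  push_cast
  ring

/-- `deg Q″ < deg Q + 1`. [folklore] -/
theorem natDegree_derivative_derivative_lt (Q : ℝ[X]) :
    (derivative (derivative Q)).natDegree < Q.natDegree + 1 := by
  have h1 := natDegree_derivative_le (derivative Q)
  have h2 := natDegree_derivative_le Q
  omega

/-- Re-indexing `j = b + 2` on `range (d+1)` for a sequence vanishing at `0, 1, d+1, d+2`. [folklore] -/
theorem sum_range_shift_two (g : ℕ → ℝ) (d : ℕ) (h0 : g 0 = 0) (h1 : g 1 = 0) (hd1 : g (d + 1) = 0)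
    (hd2 : g (d + 2) = 0) :
    ∑ j ∈ range (d + 1), g j = ∑ b ∈ range (d + 1), g (b + 2) := by
  have hA : ∑ j ∈ range (d + 3), g j = ∑ j ∈ range (d + 1), g j := by
    rw [Finset.sum_range_succ, Finset.sum_range_succ, hd1, hd2, add_zero, add_zero]
  have hB : ∑ j ∈ range (d + 3), g j = ∑ b ∈ range (d + 1), g (b + 2) := by
    rw [Finset.sum_range_succ', Finset.sum_range_succ', h0, h1, add_zero, add_zero]
  rw [← hA, hB]

/-- `Q_j = 0` for `j = deg Q + 1`, `deg Q + 2`. [folklore] -/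
theorem coeff_natDegree_add_eq_zero (Q : ℝ[X]) {k : ℕ} (hk : 1 ≤ k) : Q.coeff (Q.natDegree + k) = 0 :=
  coeff_eq_zero_of_natDegree_lt (by omega)

/-- **`I(Q·Q″) = Σᵢ Σⱼ QᵢQⱼ·j(j−1)/(i+j−1)`** over `i, j ≤ deg Q` (the terms `j = 0, 1` vanish by their numerator).
[cite: KowalskiMichelVanderKam2000, §7 (33) — derivation] -/
theorem unitIntegral_mul_derivative_two_eq_sum_sum (Q : ℝ[X]) :
    unitIntegral (Q * derivative (derivative Q)) =
      ∑ i ∈ range (Q.natDegree + 1), ∑ j ∈ range (Q.natDegree + 1),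
        Q.coeff i * Q.coeff j * (((j : ℝ) * ((j : ℝ) - 1)) / ((i : ℝ) + j - 1)) := by
  rw [unitIntegral_mul_eq_sum_sum Q _ (Nat.lt_succ_self _) (natDegree_derivative_derivative_lt Q)]
  refine Finset.sum_congr rfl fun i _ ↦ ?_
  rw [sum_range_shift_two (fun j ↦ Q.coeff i * Q.coeff j * (((j : ℝ) * ((j : ℝ) - 1)) / ((i : ℝ) + j - 1)))
    Q.natDegree (by simp) (by simp) (by simp) (by simp [coeff_natDegree_add_eq_zero])]
  refine Finset.sum_congr rfl fun b _ ↦ ?_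
  rw [coeff_derivative_derivative]
  push_cast
  ring

/-- **`I(Q″²) = Σᵢ Σⱼ QᵢQⱼ·i(i−1)j(j−1)/(i+j−3)`** over `i, j ≤ deg Q` (the terms with `i ≤ 1` or `j ≤ 1` vanish by their
numerator). [cite: KowalskiMichelVanderKam2000, §7 (33) — derivation] -/
theorem unitIntegral_derivative_two_sq_eq_sum_sum (Q : ℝ[X]) :
    unitIntegral (derivative (derivative Q) ^ 2) =
      ∑ i ∈ range (Q.natDegree + 1), ∑ j ∈ range (Q.natDegree + 1),
        Q.coeff i * Q.coeff j * (((i : ℝ) * ((i : ℝ) - 1)) * ((j : ℝ) * ((j : ℝ) - 1)) / ((i : ℝ) + j - 3)) := by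
  rw [sq, unitIntegral_mul_eq_sum_sum _ _ (natDegree_derivative_derivative_lt Q) (natDegree_derivative_derivative_lt Q)]
  -- re-index the inner variable first, then the outer one
  have hinner : ∀ a : ℕ, ∑ b ∈ range (Q.natDegree + 1),
      (derivative (derivative Q)).coeff a * (derivative (derivative Q)).coeff b / ((a : ℝ) + b + 1) =
      ∑ j ∈ range (Q.natDegree + 1), Q.coeff (a + 2) * (((a : ℝ) + 2) * ((a : ℝ) + 1)) * Q.coeff j *
        (((j : ℝ) * ((j : ℝ) - 1)) / ((a : ℝ) + 2 + j - 3)) := by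
    intro a
    rw [sum_range_shift_two (fun j ↦ Q.coeff (a + 2) * (((a : ℝ) + 2) * ((a : ℝ) + 1)) * Q.coeff j *
        (((j : ℝ) * ((j : ℝ) - 1)) / ((a : ℝ) + 2 + j - 3))) Q.natDegree (by simp) (by simp)
      (by simp) (by simp [coeff_natDegree_add_eq_zero])]
    refine Finset.sum_congr rfl fun b _ ↦ ?_
    rw [coeff_derivative_derivative, coeff_derivative_derivative]
    push_cast
    ring
  simp_rw [hinner]
  rw [sum_range_shift_two (fun i ↦ ∑ j ∈ range (Q.natDegree + 1),
      Q.coeff i * Q.coeff j * (((i : ℝ) * ((i : ℝ) - 1)) * ((j : ℝ) * ((j : ℝ) - 1)) / ((i : ℝ) + j - 3)))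
    Q.natDegree (by simp) (by simp) (by simp) (by simp [coeff_natDegree_add_eq_zero])]
  refine Finset.sum_congr rfl fun a _ ↦ Finset.sum_congr rfl fun j _ ↦ ?_
  push_cast
  ring

/-! ### `secondMomentForm` order by order -/

/-- Symmetrisation of the `I(QQ″)` double sum:
`2·Σᵢⱼ QᵢQⱼ·j(j−1)/(i+j−1) = Σᵢⱼ QᵢQⱼ·(i(i−1)+j(j−1))/(i+j−1)`. [folklore] -/
theorem sum_sum_symmetrise (Q : ℝ[X]) (s : Finset ℕ) :
    2 * ∑ i ∈ s, ∑ j ∈ s, Q.coeff i * Q.coeff j * (((j : ℝ) * ((j : ℝ) - 1)) / ((i : ℝ) + j - 1)) =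
      ∑ i ∈ s, ∑ j ∈ s, Q.coeff i * Q.coeff j * ((((i : ℝ) * ((i : ℝ) - 1)) + (j : ℝ) * ((j : ℝ) - 1)) / ((i : ℝ) + j - 1)) := by
  have hswap : ∑ i ∈ s, ∑ j ∈ s, Q.coeff i * Q.coeff j * (((j : ℝ) * ((j : ℝ) - 1)) / ((i : ℝ) + j - 1)) =
      ∑ i ∈ s, ∑ j ∈ s, Q.coeff i * Q.coeff j * (((i : ℝ) * ((i : ℝ) - 1)) / ((i : ℝ) + j - 1)) := by
    rw [Finset.sum_comm]
    exact Finset.sum_congr rfl fun i _ ↦ Finset.sum_congr rfl fun j _ ↦ by rw [add_comm (j : ℝ) i]; ring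
  rw [two_mul]
  nth_rewrite 1 [hswap]
  rw [← Finset.sum_add_distrib]
  refine Finset.sum_congr rfl fun i _ ↦ ?_
  rw [← Finset.sum_add_distrib]
  exact Finset.sum_congr rfl fun j _ ↦ by ring

/-- Bookkeeping: four double sums with constant factors combine into one (the shape produced by
`offDiagForm_eq_expanded`). [folklore] -/
private theorem sum_sum_combine (s : Finset ℕ) (f₁ f₂ f₃ f₄ : ℕ → ℕ → ℝ) (a b c I₁ I₂ I₃ : ℝ) :
    (∑ i ∈ s, ∑ j ∈ s, f₁ i j) + (a * (∑ i ∈ s, ∑ j ∈ s, f₂ i j) * I₁ - b * I₂ * (∑ i ∈ s, ∑ j ∈ s, f₃ i j) +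
        c * (∑ i ∈ s, ∑ j ∈ s, f₄ i j) * I₃) =
      ∑ i ∈ s, ∑ j ∈ s, (f₁ i j + a * I₁ * f₂ i j - b * I₂ * f₃ i j + c * I₃ * f₄ i j) := by
  have h2 : a * (∑ i ∈ s, ∑ j ∈ s, f₂ i j) * I₁ = ∑ i ∈ s, ∑ j ∈ s, a * I₁ * f₂ i j := by
    rw [mul_comm, ← mul_assoc, Finset.mul_sum]
    exact Finset.sum_congr rfl fun i _ ↦ by rw [Finset.mul_sum]; exact Finset.sum_congr rfl fun j _ ↦ by ring
  have h3 : b * I₂ * (∑ i ∈ s, ∑ j ∈ s, f₃ i j) = ∑ i ∈ s, ∑ j ∈ s, b * I₂ * f₃ i j := by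
    rw [Finset.mul_sum]
    exact Finset.sum_congr rfl fun i _ ↦ by rw [Finset.mul_sum]
  have h4 : c * (∑ i ∈ s, ∑ j ∈ s, f₄ i j) * I₃ = ∑ i ∈ s, ∑ j ∈ s, c * I₃ * f₄ i j := by
    rw [mul_comm, ← mul_assoc, Finset.mul_sum]
    exact Finset.sum_congr rfl fun i _ ↦ by rw [Finset.mul_sum]; exact Finset.sum_congr rfl fun j _ ↦ by ring
  rw [h2, h3, h4, ← Finset.sum_sub_distrib, ← Finset.sum_add_distrib, ← Finset.sum_add_distrib]
  refine Finset.sum_congr rfl fun i _ ↦ ?_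
  rw [← Finset.sum_sub_distrib, ← Finset.sum_add_distrib, ← Finset.sum_add_distrib]
  exact Finset.sum_congr rfl fun j _ ↦ by ring

/-- **`secondMomentForm` ORDER BY ORDER (every `Q`, `Δ ≠ 0`):
`secondMomentForm Δ P Q = Σ_{i,j ≤ deg Q} QᵢQⱼ·B_{ij}(Δ,P)` with
`B_{ij} = (P′(1)+iΔP(1))(P′(1)+jΔP(1)) + Δ⁻¹I(P″²)/(i+j+1) − Δ·(i(i−1)+j(j−1))/(i+j−1)·I(P″P) + Δ³·i(i−1)j(j−1)/(i+j−3)·I(P²)`**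
(`I = ∫₀¹`; a term whose numerator vanishes is `0`). From `linForm² + offDiagForm` and `KMV2000.offDiagForm_eq_expanded`.
[cite: KowalskiMichelVanderKam2000, §6 (31)–(32), §7 (33) — derivation] -/
theorem secondMomentForm_eq_sum_orders {Δ : ℝ} (hΔ : Δ ≠ 0) (P Q : ℝ[X]) :
    secondMomentForm Δ P Q = ∑ i ∈ range (Q.natDegree + 1), ∑ j ∈ range (Q.natDegree + 1),
      Q.coeff i * Q.coeff j *
        (((derivative P).eval 1 + (i : ℝ) * Δ * P.eval 1) * ((derivative P).eval 1 + (j : ℝ) * Δ * P.eval 1) +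
          Δ⁻¹ * unitIntegral (derivative (derivative P) ^ 2) / ((i : ℝ) + j + 1) -
          Δ * ((((i : ℝ) * ((i : ℝ) - 1)) + (j : ℝ) * ((j : ℝ) - 1)) / ((i : ℝ) + j - 1)) *
            unitIntegral (derivative (derivative P) * P) +
          Δ ^ 3 * (((i : ℝ) * ((i : ℝ) - 1)) * ((j : ℝ) * ((j : ℝ) - 1)) / ((i : ℝ) + j - 3)) *
            unitIntegral (P ^ 2)) := by
  unfold secondMomentForm
  have h2 : 2 * Δ * unitIntegral (Q * derivative (derivative Q)) * unitIntegral (derivative (derivative P) * P) =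
      Δ * unitIntegral (derivative (derivative P) * P) *
        ∑ i ∈ range (Q.natDegree + 1), ∑ j ∈ range (Q.natDegree + 1),
          Q.coeff i * Q.coeff j * ((((i : ℝ) * ((i : ℝ) - 1)) + (j : ℝ) * ((j : ℝ) - 1)) / ((i : ℝ) + j - 1)) := by
    rw [← sum_sum_symmetrise Q, ← unitIntegral_mul_derivative_two_eq_sum_sum Q]
    ring
  rw [offDiagForm_eq_expanded hΔ, h2, linForm_sq_eq_sum_sum Δ P Q, unitIntegral_sq_eq_sum_sum Q,
    unitIntegral_derivative_two_sq_eq_sum_sum Q, sum_sum_combine]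
  refine Finset.sum_congr rfl fun i _ ↦ Finset.sum_congr rfl fun j _ ↦ ?_
  ring

/-! ### Even-or-odd `Q`: the parity factor `1 + (−1)^{i+j}` -/

/-- For an even-or-odd `Q` (as a function on `ℝ`), `QᵢQⱼ = 0` unless `i + j` is even.
[cite: KowalskiMichelVanderKam2000, Thm. 6.1 — derivation] -/
theorem coeff_mul_coeff_eq_zero_of_isEvenOrOdd {Q : ℝ[X]} (hQ : IsEvenOrOdd Q) {i j : ℕ} (hij : Odd (i + j)) :
    Q.coeff i * Q.coeff j = 0 := by
  rcases hQ with h | h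
  · have hc : Q.comp (-X) = Q := Polynomial.funext fun x ↦ by simp [eval_comp, h x]
    rcases Nat.even_or_odd i with hi | hi
    · rcases Nat.even_or_odd j with hj | hj
      · exact absurd (hi.add hj) (Nat.not_even_iff_odd.2 hij)
      · rw [coeff_eq_zero_of_comp_neg_X_eq_self two_ne_zero hc hj, mul_zero]
    · rw [coeff_eq_zero_of_comp_neg_X_eq_self two_ne_zero hc hi, zero_mul]
  · have hc : Q.comp (-X) = -Q := Polynomial.funext fun x ↦ by simp [eval_comp, h x]
    rcases Nat.even_or_odd i with hi | hi
    · rw [coeff_eq_zero_of_comp_neg_X_eq_neg two_ne_zero hc hi, zero_mul]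
    · rcases Nat.even_or_odd j with hj | hj
      · rw [coeff_eq_zero_of_comp_neg_X_eq_neg two_ne_zero hc hj, mul_zero]
      · exact absurd (hi.add_odd hj) (Nat.not_even_iff_odd.2 hij)

/-- **For even-or-odd `Q`: `Σᵢⱼ QᵢQⱼ(1+(−1)^{i+j})·τᵢⱼ = 2·Σᵢⱼ QᵢQⱼ·τᵢⱼ`** (any finite index sets, any `τ`).
[cite: KowalskiMichelVanderKam2000, Thm. 6.1 — derivation] -/
theorem sum_sum_parity_factor {Q : ℝ[X]} (hQ : IsEvenOrOdd Q) (s t : Finset ℕ) (τ : ℕ → ℕ → ℝ) :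
    ∑ i ∈ s, ∑ j ∈ t, Q.coeff i * Q.coeff j * (1 + (-1 : ℝ) ^ (i + j)) * τ i j =
      2 * ∑ i ∈ s, ∑ j ∈ t, Q.coeff i * Q.coeff j * τ i j := by
  rw [Finset.mul_sum]
  refine Finset.sum_congr rfl fun i _ ↦ ?_
  rw [Finset.mul_sum]
  refine Finset.sum_congr rfl fun j _ ↦ ?_
  rcases Nat.even_or_odd (i + j) with hij | hij
  · rw [hij.neg_one_pow]
    ring
  · rw [coeff_mul_coeff_eq_zero_of_isEvenOrOdd hQ hij]
    ring

/-- **For even-or-odd `Q` and `Δ ≠ 0`: `Σ_{i,j ≤ deg Q} QᵢQⱼ(1+(−1)^{i+j})·(B_{ij}(Δ,P)/2) = secondMomentForm Δ P Q`** — with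
the per-order targets `τ_{ij} := B_{ij}/2` the assembled level-free functional IS `secondMomentForm`.
[cite: KowalskiMichelVanderKam2000, §6 (31), Thm. 6.1 — derivation] -/
theorem secondMomentForm_eq_sum_orders_parity {Δ : ℝ} (hΔ : Δ ≠ 0) {P Q : ℝ[X]} (hQ : IsEvenOrOdd Q) :
    ∑ i ∈ range (Q.natDegree + 1), ∑ j ∈ range (Q.natDegree + 1),
      Q.coeff i * Q.coeff j * (1 + (-1 : ℝ) ^ (i + j)) *
        ((((derivative P).eval 1 + (i : ℝ) * Δ * P.eval 1) * ((derivative P).eval 1 + (j : ℝ) * Δ * P.eval 1) +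
          Δ⁻¹ * unitIntegral (derivative (derivative P) ^ 2) / ((i : ℝ) + j + 1) -
          Δ * ((((i : ℝ) * ((i : ℝ) - 1)) + (j : ℝ) * ((j : ℝ) - 1)) / ((i : ℝ) + j - 1)) *
            unitIntegral (derivative (derivative P) * P) +
          Δ ^ 3 * (((i : ℝ) * ((i : ℝ) - 1)) * ((j : ℝ) * ((j : ℝ) - 1)) / ((i : ℝ) + j - 3)) *
            unitIntegral (P ^ 2)) / 2) =
      secondMomentForm Δ P Q := by
  rw [sum_sum_parity_factor hQ, secondMomentForm_eq_sum_orders hΔ, Finset.mul_sum]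
  refine Finset.sum_congr rfl fun i _ ↦ ?_
  rw [Finset.mul_sum]
  exact Finset.sum_congr rfl fun j _ ↦ by ring

/-! ### Consequence for the shape statements -/

/-- `HasShape` only sees the functional on admissible `P`, even-or-odd `Q` and `Δ' ∈ (1, Δ]`: two functionals agreeing there
give the same shape statement. [folklore] -/
theorem hasShape_congr (F : LevelFamily) (Δ : ℝ) {t t' : ℝ → ℝ[X] → ℝ[X] → ℝ}
    (htt' : ∀ Δ' : ℝ, ∀ P Q : ℝ[X], KMV2000.Admissible P → IsEvenOrOdd Q → 1 < Δ' → Δ' ≤ Δ → t Δ' P Q = t' Δ' P Q)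
    (h : HasShape F Δ t) : HasShape F Δ t' := by
  intro P Q hP hQ Δ' h1 h2
  obtain ⟨C, q₀, hC⟩ := h P Q hP hQ Δ' h1 h2
  refine ⟨C, q₀, fun q _ hq hq₀ hn ↦ ?_⟩
  rw [← htt' Δ' P Q hP hQ h1 h2]
  exact hC q hq hq₀ hn

/-- **`τ_{ij} = B_{ij}/2` gives the printed functional**: for any level family `F`,
`HasShape F Δ (Σ_{i,j ≤ deg Q} QᵢQⱼ(1+(−1)^{i+j})·B_{ij}(Δ',P)/2) → HasShape F Δ secondMomentForm` (`Δ' > 1` on the window,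
so `Δ' ≠ 0`). With `F = diagPart` this is the identification `t_D = secondMomentForm` of the per-order assembly
(`…DiagOrderAssembly` / `…DiagOrderSelberg` with `τ := B/2`). [cite: KowalskiMichelVanderKam2000, §6 (31) — derivation] -/
theorem hasShape_secondMomentForm_of_orderForm (F : LevelFamily) (Δ : ℝ)
    (h : HasShape F Δ (fun Δ' P Q ↦ ∑ i ∈ range (Q.natDegree + 1), ∑ j ∈ range (Q.natDegree + 1),
      Q.coeff i * Q.coeff j * (1 + (-1 : ℝ) ^ (i + j)) *
        ((((derivative P).eval 1 + (i : ℝ) * Δ' * P.eval 1) * ((derivative P).eval 1 + (j : ℝ) * Δ' * P.eval 1) +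
          Δ'⁻¹ * unitIntegral (derivative (derivative P) ^ 2) / ((i : ℝ) + j + 1) -
          Δ' * ((((i : ℝ) * ((i : ℝ) - 1)) + (j : ℝ) * ((j : ℝ) - 1)) / ((i : ℝ) + j - 1)) *
            unitIntegral (derivative (derivative P) * P) +
          Δ' ^ 3 * (((i : ℝ) * ((i : ℝ) - 1)) * ((j : ℝ) * ((j : ℝ) - 1)) / ((i : ℝ) + j - 3)) *
            unitIntegral (P ^ 2)) / 2))) :
    HasShape F Δ (fun Δ' P Q ↦ secondMomentForm Δ' P Q) :=
  hasShape_congr F Δ (fun Δ' P Q _ hQ h1 _ ↦ secondMomentForm_eq_sum_orders_parity (by linarith) hQ (P := P)) h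

end Summit.Parity.GeneralizedHardyLittlewood.Theorems.MomentsBeyondDiagonal.DiagLines

end
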